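import Summits.BirchSwinnertonDyer.BirchSwinnertonDyer.Theorems.GenusKolyvaginAtTwoMinimalTwinBSDTwoSwappedPairRationalHeegnerPoint
import HarnessLib

/-!
# Route `GenusKolyvaginAtTwo`, crux U₂ `MinimalTwinBSDTwo` (stmt-BirchSwinnertonDyer-22985), LINE 23 «twin_swap» v2.5:
# THE `2`-DEPTH OF `P(1)` IN `E(K[1])` IS THE `2`-DEPTH OF THE RATIONAL HEEGNER POINT IN `E(ℚ)` — at every depth

Width seat `bsd-line-gk2-p4` g37 (cell `bsd-f1-sign2`), `--supports stmt-BirchSwinnertonDyer-22985` (helper; closes nothing).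
THEOREMS ONLY (no definition, no named fact, no `sorry`); standard axioms; UNCONDITIONAL.
**BSD is NOT proved by any of this; U₂ / hTw / DIV′ / NDIV′ are NOT proved; nothing is closed.**
Sequel of g26's `…SwappedPairRationalHeegnerPoint` (the rational Heegner point `Y` with `ι Y = P₀ + 2u` for `w(E) = −1`, and the depth-ONE reading
«`P(1) ∈ 2E(K[1]) ⟺ κ₂(Y) = 0`»); the companion `…SwappedPairLocalBitIdentity` (this seat) reads the identity door's local bit with it.

WHY.  LINE 23's research stubs are now all of ONE shape «`2^{e} ∥ P(1)` in `E(K[1])`» — v2.5's halves DIV′/NDIV′ at an exact depth `M₀`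
(`Cruxes/MinimalTwinBSDTwo/Lines/twin_swap.lean`), gk2-p2/gk2-p3's EXP⁻_all / EXP⁺_all / EXP_id with `e = ord₂ c + ord₂ C(W)` resp. `e + 1`
(`…IdentityDoorCellsExp`).  g26 read depth ONE on the rational Heegner point; this file reads EVERY depth there: `M₀` is the exact `2`-depth of ONE
rational point in the Mordell–Weil group OVER `ℚ` — no heights, no generator, no field larger than `ℚ` (instrument: `Y` and `2`-division in `E(ℚ)`).

* §1 (generic quadratic `L/F`, `V(L)[2] = 0`, `ι Y = P₀ + 2u`, `u` torsion) **`exists_two_pow_smul_iff_of_incl_eq`** — for every `M`: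
  **`P₀ ∈ 2^M V(L) ⟺ Y ∈ 2^M V(F)`** (`u` has odd order, so is `2^M`-divisible; a `2^M`-th root of `ι Y` is `σ`-fixed because its `σ`-defect is
  `2^M`-torsion; Galois descent).  g26's `exists_two_smul_iff_of_incl_eq` is `M = 1`.  `kummerMapTorsion_eq_zero_iff_exists_smul_dec` — g26's
  Kummer reading `κ_n(Y) = 0 ⟺ Y ∈ nV(F)` for an ARBITRARY `DecidableEq F` instance (at `F = ℚ` Lean elaborates `instDecidableEqRat`).
* §2 (`E/ℚ`, odd-`d_K` Heegner field, `E(ℚ)[2] = 0`) **`exists_two_pow_smul_derivedPoint_iff`** — for every `M`: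
  **`2^M ∣ P(1)` in `E(K[1])` ⟺ `2^M ∣ Y` in `E(ℚ)`** (McCallum 5.1's descent `K[1] → K` at depth `M`, `Koly.pDiv_one_iff_exists_zsmul_eq`, then §1);
  **`exactTwoDepth_derivedPoint_iff`** — `2^{M₀} ∥ P(1) ⟺ 2^{M₀} ∥ Y`; **`exists_rational_heegnerPoint_forall_two_pow_smul_iff`** — packaged for
  `r_an(E) = 1` (root number `−1`): SOME rational `Y` with `ι Y = P₀ + 2u` reads every depth of `P(1)`.

References: [GrossLMS1991] §4 (4.1), Lemma 4.3, §5 Prop. 5.3; [McCallumLMS1991] §5 Lemma 5.1; [Darmon2004] Prop. 3.11;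
[SilvermanAEC2009] VIII §2, X Exercise 10.16.
-/

set_option autoImplicit false
set_option linter.dupNamespace false -- `Summit.<P>.<Sub>` repeats `BirchSwinnertonDyer` (D-0017)

noncomputable section

open scoped Classical NumberField

namespace Summit.BirchSwinnertonDyer.BirchSwinnertonDyer.Theorems.GenusExact.TwinSwapBit

open IsDedekindDomain Field NumberField WeierstrassCurve Literature.NumberTheory.EllipticCurves
  Literature.NumberTheory.EllipticCurves.ModularForms Literature.NumberTheory.GaloisRepresentations
open Summit.BirchSwinnertonDyer.BirchSwinnertonDyer.Theorems.GenusExact.PlusDescent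
open Summit.BirchSwinnertonDyer.BirchSwinnertonDyer.Theorems.GenusExact.TwinSwap
open Summit.BirchSwinnertonDyer.BirchSwinnertonDyer.Theorems.GenusKolyArch (hdiv_two)
open Summit.BirchSwinnertonDyer.Rank1Residual.X11b (LocalIndex.mem_range_nsmul_pow_of_isOfFinAddOrder)
open Summit.BirchSwinnertonDyer.Rank1Residual.X11b.Three (Koly.pDiv_one_iff_exists_zsmul_eq Koly.PDiv)

/-! ## §0 Bookkeeping: no `2`-torsion ⟹ no `2^M`-torsion; odd-order torsion is `2^M`-divisible -/

/-- Without `2`-torsion there is no `2^M`-torsion. [folklore] -/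
private theorem eq_zero_of_two_pow_zsmul_eq_zero {A : Type*} [AddCommGroup A]
    (h2 : ∀ T : A, (2 : ℤ) • T = 0 → T = 0) (M : ℕ) (T : A) (hT : ((2 ^ M : ℕ) : ℤ) • T = 0) : T = 0 := by
  induction M generalizing T with
  | zero => simpa using hT
  | succ M ih =>
    refine h2 T (ih ((2 : ℤ) • T) ?_)
    have h : ((2 ^ M : ℕ) : ℤ) * 2 = ((2 ^ (M + 1) : ℕ) : ℤ) := by simp [pow_succ]
    rw [smul_smul, h]
    exact hT

/-- Without `2`-torsion every element of finite order is a `2^M`-th multiple (its order is odd). [folklore] -/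
private theorem exists_two_pow_zsmul_eq_of_isOfFinAddOrder {A : Type*} [AddCommGroup A]
    (h2 : ∀ T : A, (2 : ℤ) • T = 0 → T = 0) (M : ℕ) {u : A} (hu : IsOfFinAddOrder u) :
    ∃ u' : A, ((2 ^ M : ℕ) : ℤ) • u' = u := by
  haveI : Fact (Nat.Prime 2) := ⟨Nat.prime_two⟩
  have hiv : ∀ g : A, 2 • g = 0 → g = 0 := fun g hg ↦ h2 g (by rw [two_zsmul]; rw [two_nsmul] at hg; exact hg)
  obtain ⟨u', hu'⟩ := LocalIndex.mem_range_nsmul_pow_of_isOfFinAddOrder hiv M hu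
  refine ⟨u', ?_⟩
  rw [natCast_zsmul, ← nsmulAddMonoidHom_apply]
  exact hu'

/-! ## §1 Generic quadratic descent `L/F` at every depth -/

section Generic

variable {F : Type} {L : Type} [Field F] [Field L] [Algebra F L] [NeZero (2 : F)]

omit [NeZero (2 : F)] in
/-- **`κ_n(Y) = 0 ⟺ Y ∈ nV(F)`** (exactness of the Kummer sequence at `V(F)/n`; g26's `kummerMapTorsion_eq_zero_iff_exists_smul`) stated for an
ARBITRARY `DecidableEq F` instance on the point group: at `F = ℚ` Lean elaborates `instDecidableEqRat`, the generic lemma the classical instance; they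
agree by `Subsingleton.elim`, so this form instantiates on the nose over `ℚ`.  [cite: SilvermanAEC2009, VIII §2] -/
theorem kummerMapTorsion_eq_zero_iff_exists_smul_dec [PerfectField F] [DecidableEq F] (V : WeierstrassCurve F) {n : ℤ}
    (hdiv : ∀ P : geomPoints V, ∃ Q : geomPoints V, n • Q = P) (Y : V.toAffine.Point) :
    kummerMapTorsion V n hdiv Y = 0 ↔ ∃ Q₀ : V.toAffine.Point, n • Q₀ = Y := by
  obtain rfl : ‹DecidableEq F› = fun a b ↦ Classical.propDecidable (a = b) := Subsingleton.elim _ _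
  exact kummerMapTorsion_eq_zero_iff_exists_smul V hdiv Y

/-- **`P₀ ∈ 2^M V(L) ⟺ Y ∈ 2^M V(F)`** when `ι Y = P₀ + 2u` with `u` torsion (`L/F` quadratic, `σ ≠ 1`, `V(L)[2] = 0`), for EVERY `M`.
`u` has odd order, so `u = 2^M u'`; a `2^M`-th root `Q` of `P₀` gives the `2^M`-th root `Q + 2u'` of `ι Y`, which is `σ`-fixed (its `σ`-translate
differs from it by `2^M`-torsion, and `V(L)` has none) and descends to `V(F)`; conversely `ι Q₀ − 2u'` is a `2^M`-th root of `P₀`.  g26's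
`exists_two_smul_iff_of_incl_eq` is the case `M = 1`.  Stated for an arbitrary `DecidableEq F` instance on `V(F)` (so that it instantiates at
`F = ℚ` with `instDecidableEqRat`).  [cite: SilvermanAEC2009, X, Exercise 10.16] [cite: McCallumLMS1991, §5 Lemma 5.1 (proof)] -/
theorem exists_two_pow_smul_iff_of_incl_eq [DecidableEq F] (h2 : Module.finrank F L = 2) (V : WeierstrassCurve F)
    {σ : L →ₐ[F] L} (hσ : σ ≠ AlgHom.id F L)
    (h2L : ∀ T : (V.baseChange L).toAffine.Point, (2 : ℤ) • T = 0 → T = 0)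
    {P₀ u : (V.baseChange L).toAffine.Point} (hu : IsOfFinAddOrder u) {Y : V.toAffine.Point}
    (hY : QuadraticDescent.incl L V Y = P₀ + (2 : ℤ) • u) (M : ℕ) :
    (∃ Q : (V.baseChange L).toAffine.Point, ((2 ^ M : ℕ) : ℤ) • Q = P₀) ↔
      ∃ Q₀ : V.toAffine.Point, ((2 ^ M : ℕ) : ℤ) • Q₀ = Y := by
  obtain rfl : ‹DecidableEq F› = fun a b ↦ Classical.propDecidable (a = b) := Subsingleton.elim _ _
  -- `u` (odd order) is `2^M`-divisible
  obtain ⟨u', hu'⟩ := exists_two_pow_zsmul_eq_of_isOfFinAddOrder h2L M hu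
  constructor
  · rintro ⟨Q, hQ⟩
    set R : (V.baseChange L).toAffine.Point := Q + (2 : ℤ) • u' with hR
    have hYR : QuadraticDescent.incl L V Y = ((2 ^ M : ℕ) : ℤ) • R := by
      rw [hY, hR, zsmul_add, hQ, smul_comm, hu']
    have hRfix : QuadraticDescent.conjMap V σ R = R := by
      have h0 : ((2 ^ M : ℕ) : ℤ) • (QuadraticDescent.conjMap V σ R - R) = 0 := by
        rw [zsmul_sub, ← map_zsmul, ← hYR, QuadraticDescent.conjMap_incl, sub_self]
      exact sub_eq_zero.mp (eq_zero_of_two_pow_zsmul_eq_zero h2L M _ h0)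
    obtain ⟨Q₀, hQ₀⟩ := QuadraticDescent.exists_incl_eq_of_conjMap_eq h2 V hσ hRfix
    refine ⟨Q₀, QuadraticDescent.incl_injective (K := L) V ?_⟩
    rw [map_zsmul, hQ₀, hYR]
  · rintro ⟨Q₀, hQ₀⟩
    refine ⟨QuadraticDescent.incl L V Q₀ - (2 : ℤ) • u', ?_⟩
    rw [zsmul_sub, ← map_zsmul, hQ₀, hY, smul_comm, hu']
    abel

end Generic

/-! ## §2 `E/ℚ`: the `2`-depth of `P(1)` in `E(K[1])` is the `2`-depth of the rational Heegner point in `E(ℚ)` -/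

variable (W : WeierstrassCurve ℚ) [W.IsElliptic] [W.IsGloballyMinimal] {K : Type} [Field K] [NumberField K]

/-- **`2^M ∣ P(1)` in `E(K[1])` ⟺ `2^M ∣ Y` in `E(ℚ)`, for every `M`.**  `E/ℚ` globally minimal, `K` imaginary quadratic with odd `d_K`,
Heegner for `N_E`, `E(ℚ)[2] = 0` (hence `E(K)[2] = 0` and `E(K[1])[2^M] = 0`: Gross's Lemma 4.3 at `2` for a Heegner field of odd discriminant,
tree `Uniform.U2.RingClass`); `d₁` a conductor-`1` Kolyvagin–Heegner datum, `P₀ ∈ E(K)` over `P(1)`, and `Y ∈ E(ℚ)`, `u ∈ E(K)_tors` with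
`ι Y = P₀ + 2u` (g26's rational Heegner point).  McCallum 5.1 at depth `M` (`K[1] → K`, `Koly.pDiv_one_iff_exists_zsmul_eq`) and §1 (`K → ℚ`).
[cite: McCallumLMS1991, §5 Lemma 5.1] [cite: GrossLMS1991, §4 Lemma 4.3] [cite: SilvermanAEC2009, X, Exercise 10.16] -/
theorem exists_two_pow_smul_derivedPoint_iff [NeZero (W.conductorNorm ℤ)] (hK : IsImaginaryQuadratic K)
    (hodd : Odd (NumberField.discr K)) (hH : SatisfiesHeegnerHypothesis (W.conductorNorm ℤ) K)
    (hT2 : ∀ P : W.toAffine.Point, 2 • P = 0 → P = 0)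
    (Dt : ModularParametrizationData W (W.conductorNorm ℤ)) (β : ℤ) (ι : K →+* ℂ) (d₁ : KolyvaginHeegnerData Dt β ι 1)
    {P₀ : (W.baseChange K).toAffine.Point} {Y : W.toAffine.Point} {u : (W.baseChange K).toAffine.Point}
    (hP₀ : Affine.Point.map (W' := W) (algebraMap K (ringClassField K ι 1)).toRatAlgHom P₀ = d₁.derivedPoint)
    (hu : IsOfFinAddOrder u) (hY : QuadraticDescent.incl K W Y = P₀ + (2 : ℤ) • u) (M : ℕ) :
    (∃ Q : (W.baseChange (ringClassField K ι 1)).toAffine.Point, ((2 ^ M : ℕ) : ℤ) • Q = d₁.derivedPoint) ↔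
      ∃ Q₀ : W.toAffine.Point, ((2 ^ M : ℕ) : ℤ) • Q₀ = Y := by
  have h2 : Module.finrank ℚ K = 2 := hK.1
  -- no `2`-torsion (hence no `2^M`-torsion) over `K[1]`, and none over `K`
  have hD4 : NumberField.discr K % 4 = 1 := Literature.NumberTheory.QuadraticFields.Quadratic.discr_emod_four_eq_one hK.1 hodd
  haveI : NumberField (ringClassField K ι 1) := numberField_ringClassField hK ι one_ne_zero
  have htor2 : ∀ R : (W.baseChange (ringClassField K ι 1)).toAffine.Point, (2 : ℤ) • R = 0 → R = 0 := fun R hR ↦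
    Summit.BirchSwinnertonDyer.Uniform.U2.RingClass.forall_two_nsmul_eq_zero_of_heegner W hK ι hD4 hH
      (fun P hP ↦ by convert hT2 P (by convert hP)) one_ne_zero R (by rw [two_nsmul]; rw [two_zsmul] at hR; exact hR)
  have htorM : ∀ R : (W.baseChange (ringClassField K ι 1)).toAffine.Point, ((2 ^ M : ℕ) : ℤ) • R = 0 → R = 0 :=
    fun R hR ↦ eq_zero_of_two_pow_zsmul_eq_zero htor2 M R hR
  have h2K : ∀ x : (W.baseChange K).toAffine.Point, (2 : ℤ) • x = 0 → x = 0 := fun x hx ↦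
    forall_two_zsmul_baseChange_eq_zero_of_heegner W K hK hodd hH hT2 x hx
  -- McCallum 5.1 at depth `M`: `2^M ∣ P(1)` in `E(K[1])` iff `2^M ∣ P₀` in `E(K)`
  have hKK := Koly.pDiv_one_iff_exists_zsmul_eq hK d₁ P₀ hP₀ 2 M htorM
  simp only [Koly.PDiv] at hKK
  -- `K → ℚ` (§1)
  obtain ⟨τ, hτ1, -⟩ := exists_conj_of_isImaginaryQuadratic (K := K) hK
  have hσ : (τ : K →ₐ[ℚ] K) ≠ AlgHom.id ℚ K := fun h ↦ hτ1 (AlgEquiv.ext fun x ↦ DFunLike.congr_fun h x)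
  exact hKK.trans (exists_two_pow_smul_iff_of_incl_eq h2 W hσ h2K hu hY M)

/-- **`2^{M₀} ∥ P(1)` in `E(K[1])` ⟺ `2^{M₀} ∥ Y` in `E(ℚ)`**: the exact `2`-depth `M₀` of the stubs KEX′ / DIV′ / NDIV′ / EXP (LINE 23) is the exact
`2`-depth of the rational Heegner point in the Mordell–Weil group OVER `ℚ` (same frame as `exists_two_pow_smul_derivedPoint_iff`).
[cite: McCallumLMS1991, §5 Lemma 5.1] [cite: GrossLMS1991, §5 Prop. 5.3] -/
theorem exactTwoDepth_derivedPoint_iff [NeZero (W.conductorNorm ℤ)] (hK : IsImaginaryQuadratic K)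
    (hodd : Odd (NumberField.discr K)) (hH : SatisfiesHeegnerHypothesis (W.conductorNorm ℤ) K)
    (hT2 : ∀ P : W.toAffine.Point, 2 • P = 0 → P = 0)
    (Dt : ModularParametrizationData W (W.conductorNorm ℤ)) (β : ℤ) (ι : K →+* ℂ) (d₁ : KolyvaginHeegnerData Dt β ι 1)
    {P₀ : (W.baseChange K).toAffine.Point} {Y : W.toAffine.Point} {u : (W.baseChange K).toAffine.Point}
    (hP₀ : Affine.Point.map (W' := W) (algebraMap K (ringClassField K ι 1)).toRatAlgHom P₀ = d₁.derivedPoint)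
    (hu : IsOfFinAddOrder u) (hY : QuadraticDescent.incl K W Y = P₀ + (2 : ℤ) • u) (M₀ : ℕ) :
    ((∃ Q : (W.baseChange (ringClassField K ι 1)).toAffine.Point, ((2 ^ M₀ : ℕ) : ℤ) • Q = d₁.derivedPoint) ∧
        ¬ ∃ Q : (W.baseChange (ringClassField K ι 1)).toAffine.Point, ((2 ^ (M₀ + 1) : ℕ) : ℤ) • Q = d₁.derivedPoint) ↔
      ((∃ Q₀ : W.toAffine.Point, ((2 ^ M₀ : ℕ) : ℤ) • Q₀ = Y) ∧
        ¬ ∃ Q₀ : W.toAffine.Point, ((2 ^ (M₀ + 1) : ℕ) : ℤ) • Q₀ = Y) :=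
  and_congr (exists_two_pow_smul_derivedPoint_iff W hK hodd hH hT2 Dt β ι d₁ hP₀ hu hY M₀)
    (not_congr (exists_two_pow_smul_derivedPoint_iff W hK hodd hH hT2 Dt β ι d₁ hP₀ hu hY (M₀ + 1)))

/-- **Packaged for `r_an(E) = 1`: ONE rational point reads every depth of `P(1)`.**  `E/ℚ` globally minimal of analytic rank `1` (so
`w(E) = −1`), `E(ℚ)[2] = 0`; `K` imaginary quadratic, odd `d_K`, Heegner; `Dt`, `(β, ι)`, a conductor-`1` datum `d₁`.  THEN there are
`P₀ ∈ E(K)` over `P(1)`, a RATIONAL `Y ∈ E(ℚ)` and a torsion `u ∈ E(K)` with `ι Y = P₀ + 2u` (g26's rational Heegner point), and for EVERY `M`: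
**`2^M ∣ P(1)` in `E(K[1])` ⟺ `2^M ∣ Y` in `E(ℚ)`**.  Unconditional; credits nothing by itself.
[cite: GrossLMS1991, §5 Prop. 5.3] [cite: Darmon2004, Prop. 3.11] [cite: McCallumLMS1991, §5 Lemma 5.1] -/
theorem exists_rational_heegnerPoint_forall_two_pow_smul_iff [NeZero (W.conductorNorm ℤ)] (hr : W.analyticRank = 1)
    (hT2 : ∀ P : W.toAffine.Point, 2 • P = 0 → P = 0)
    (hK : IsImaginaryQuadratic K) (hodd : Odd (NumberField.discr K)) (hH : SatisfiesHeegnerHypothesis (W.conductorNorm ℤ) K)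
    (Dt : ModularParametrizationData W (W.conductorNorm ℤ)) (β : ℤ) (ι : K →+* ℂ) (d₁ : KolyvaginHeegnerData Dt β ι 1) :
    ∃ (P₀ : (W.baseChange K).toAffine.Point) (Y : W.toAffine.Point) (u : (W.baseChange K).toAffine.Point),
      Affine.Point.map (W' := W) (algebraMap K (ringClassField K ι 1)).toRatAlgHom P₀ = d₁.derivedPoint ∧
      IsOfFinAddOrder u ∧ QuadraticDescent.incl K W Y = P₀ + (2 : ℤ) • u ∧
      ∀ M : ℕ, (∃ Q : (W.baseChange (ringClassField K ι 1)).toAffine.Point, ((2 ^ M : ℕ) : ℤ) • Q = d₁.derivedPoint) ↔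
        ∃ Q₀ : W.toAffine.Point, ((2 ^ M : ℕ) : ℤ) • Q₀ = Y := by
  have hw : W.rootNumber = -1 := rootNumber_eq_neg_one_of_analyticRank_eq_one W hr Dt
  have h2K : ∀ x : (W.baseChange K).toAffine.Point, (2 : ℤ) • x = 0 → x = 0 := fun x hx ↦
    forall_two_zsmul_baseChange_eq_zero_of_heegner W K hK hodd hH hT2 x hx
  obtain ⟨P₀, Y, u, hP₀, hu, hY⟩ := exists_rational_heegnerPoint_of_rootNumber_eq_neg_one W hK hH hw h2K Dt β ι d₁
  exact ⟨P₀, Y, u, hP₀, hu, hY, fun M ↦ exists_two_pow_smul_derivedPoint_iff W hK hodd hH hT2 Dt β ι d₁ hP₀ hu hY M⟩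

end Summit.BirchSwinnertonDyer.BirchSwinnertonDyer.Theorems.GenusExact.TwinSwapBit

end
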